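import Summits.QuantumFields.BalabanUV.Beta.GAN24.CombCubicCellChargeZero
import Summits.QuantumFields.BalabanUV.Beta.GAN24.ZeroModeReflectionParityWords
import Summits.QuantumFields.BalabanUV.Beta.SecondOrderBorderClassKit
import Summits.QuantumFields.BalabanUV.Beta.SpineRecursivePureParity
import Summits.QuantumFields.BalabanUV.Beta.SecondOrderZeroCanon
import Summits.QuantumFields.BalabanUV.Beta.D1BFx.LiteralStencilSockets

/-!
# `BalabanUV.Beta.GAN24.CombQuarticContactChargeZero` — binder row G-an2-4 ∕ (CONV-C), W-slot, row (C) at levels ≥ 1, THE PARITY ROUTE MADE SPECIFIC (second half):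
# **THE CONTACT DEFECT OF THE COMB TOWER's QUARTIC REFLECTION LAW CARRIES NO ff CHARGE — ON ANY PATTERN, AT EVERY LEVEL, AT THE PIN, WITH NO LETTER FROM ANYBODY**
# (road-P2 chair of row G-an2-4, unit `b2b-balaban-gan24-p2` gen 48, crux team (2); READING R-2 (2)(b)(c) of gen 47 made a theorem)

NOT IN PRINT; OUR BOOKKEEPING ([folklore] re-indexing + Fubini + two Ward zeros BY NAME; 0 `def`, 0 cited facts, 0 `def … : Prop`, 0 sorry).  HONEST FRAMING (cell contract,
verbatim): «discharging `BetaPertH` makes Bałaban's UV stability UNCONDITIONAL — a real constructive-QFT result; it is NOT the continuum limit and NOT the Clay problem.»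
HONEST DEPENDENCY (verbatim): «continuum YM on T⁴ ⇐ BetaPertH ∧ nine spine estimates (0/9 proved); BetaPertH ⇐ (D1) ∧ (D4) ∧ CAP+tail; G-an2-4 gates asym, D1 and NE2/3/4.»

THE OBJECT.  an2's quartic law `SpineRecursiveT2All.T2RecAt_bref_all_of_letters` (every level `j`, axis `α`) reflects the comb tower's table `T̃_j` with the DEFECT
`J_j^α κ u κ′ u′ = conjW 𝕄_j (S_j κ u) (S_j κ′ u′) (X κ u) (X κ′ u′) (X₂ κ u κ′ u′) + R2 j α κ u κ′ u′`, `𝕄_j = bhKStepAt 3 ρ_c Lc j`, `S_j = SpureRecAt … j`, generators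
`X κ u = diagK (γ_j·ctGen 3 α Lc κ u)`, canonical second symbol `X₂ κ u κ′ u′ = diagK (γ_j²·ctGen κ u·ctGen κ′ u′)` (`SpineRecursiveT2AllCanon`), `R2` row-parity-odd `LocStencil₂`.
WHAT (generic `d` for §1–§4; the comb instance `d + 1 = 4`, odd `Lc`, centred root, pin `(cE, cVH) = (Lc⁴, −Lc⁸∕2)`, ANY `cΛ`, ANY scalars `γ, γ₂` in §5):
* §1 classes of zero letters; `conjW` with a zero sandwich∕zero second symbol IS `conjW₁`, with zero cubic letters IS `conjW₂` (so an2's `SecondOrderBorderClassKit.locStencil₂_conjW`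
  classes BOTH halves).
* §2 bond-slot summabilities of a local stencil family with one kernel leg pinned (`summable_bond_tsum_fst ∕ _snd`) and the FIRST-LEG re-centring
  `sum_box_tsum_tsum_recentre_fst` (twin of g47's `ZeroModeReflectionParityWords.sum_box_tsum_tsum_recentre`, leaf-04's `sum_box_tsum_mul_periodic` at `A := 1`).
* §3 **`zmode_conjW₁_eq_zero`** (generic): for a block-covariant local stencil family `S` with ZERO CUBIC CELL CHARGES and generators with same-bond delta field legs, the
  `conjW₁` family `κ u κ′ u′ ↦ conjW₁ (S κ u) (S κ′ u′) (diagK (g κ u)) (diagK (g κ′ u′))` has zero ff charge on every pattern — g47's `tsum_tsum_conjW₁_diagK_eq` ↦ four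
  one-leg-pinned sums ↦ two re-centrings + one Fubini ↦ four cubic cell charges.
* §4 **`zmode_conjW₂_eq_zero`** (generic): for a sandwich kernel with summable rows∕columns and zero ff constant modes and a finitely supported second symbol, the `conjW₂`
  family has zero ff charge on every pattern — g47's `tsum_tsum_conjW₂_diagK_eq` leaves the sandwich entries `𝕄 u u′`, `𝕄 u′ u`, whose `u′`-sums are constant modes again.
* §5 **THE COMB INSTANCE `zmode_conjW_comb_eq_zero (hLc : Odd Lc) (cΛ γ γ₂) (j) (α κ κ′ κ₁ κ₂)`:
  `zmode Lc (fun κ u κ′ u′ => conjW 𝕄_j (S_j κ u) (S_j κ′ u′) (diagK (γ·ctGen α κ u)) (diagK (γ·ctGen α κ′ u′)) (diagK (γ₂·ctGen α κ u·ctGen α κ′ u′))) κ κ′ (inl κ₁) (inl κ₂) = 0`**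
  — `CombCubicCellChargeZero` (§3's cubic charges, §4's Ward zeros) + `WSlotFirstDiff.zmode_add` over the kit's classes.
CONSEQUENCE (located, zero weight): with g47's `ZeroModeReflectionParity.zmode_inl_inl_add_legSwap_eq_zero_of_parityOdd` (`R2`) the WHOLE defect `J_j^α` adds no
LEG-SYMMETRISED ff charge; by `two_mul_zmode_eq_neg_of_reflSign_prod` the odd-multiplicity half of (C)_{≥1} (216∕256 patterns at `d = 3`) then rests on EXACTLY ONE input —
the quartic TABLE-level law at the literal with its letters discharged (WANTED W-an2-1).  Discharges NOTHING of (C)_{≥1} ∕ (Q-L) ∕ (H1♮) by itself; asserts NOTHING about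
`T2RecAt`; (β) of record untouched; NEVER «G-an2-4 closed» as (CONV-C); NOT D1, NOT `BetaPertH`, NOT continuum, NOT Clay.  2026-08-23; no existing file touched.
-/

noncomputable section

open Finset
open scoped BigOperators
open Literature.MathematicalPhysics.QuantumFieldTheory
open Literature.MathematicalPhysics.QuantumFieldTheory.Balaban1983to89
open Literature.MathematicalPhysics.QuantumFieldTheory.Balaban1983to89.Beta
open ExpKernelCalculus (MKer shiftK BiLoc Decays comp summable_exp_shift summable_exp_shift' Zl)
open B12Sec2to5 (l1)
open OneStepResolventKernel (Fib LocStencil)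
open BalabanStepJets (locStencil_mono)
open OneStepResolventKernel (decays_mono)
open AffineAveraging (box toSite)
open AveragingContoursRooted (ctrOff ctrOff_mem_box)
open BalabanCompositeJets (LocStencil₂)
open BalabanStepJetsSucc (wVH)
open AxialDressing (summable_col_of_biLoc summable_row_of_biLoc)
open Summit.QuantumFields.BalabanUV.Beta.TameKernelCalculus (trK trK_apply biLoc_trK)
open Summit.QuantumFields.BalabanUV.Beta.ChartConjugation (conjV conjW conjW₁ conjW₂)
open Summit.QuantumFields.BalabanUV.Beta.BorderedHessian (diagK ctGen ctGen_inl bhKStepAt stepScale spr_bhKStepAt)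
open Summit.QuantumFields.BalabanUV.Beta.SpineRooted (SpureRecAt SpureRecAt_translate locStencil_SpureRecAt)
open Summit.QuantumFields.BalabanUV.Beta.SecondOrderBorderClassKit (locStencil₂_conjW)
open Summit.QuantumFields.BalabanUV.Beta.SpineRecursivePureParity (locStencil_diagK_smul_ctGen)
open Summit.QuantumFields.BalabanUV.Beta.SecondOrderZeroCanon (locStencil₂_diagK_ctGen_mul_ctGen)
open Summit.QuantumFields.BalabanUV.Beta.GAN24.BiStencilZeroMode (Tab zmode)
open Summit.QuantumFields.BalabanUV.Beta.GAN24.WSlotFirstDiff (zmode_add summable_z summable_xz abs_tsum_z_le)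
open Summit.QuantumFields.BalabanUV.Beta.GAN24.KernelLegCharges (summable_prod_of_biLoc)
open Summit.QuantumFields.BalabanUV.Beta.GAN24.CovariantFamilyCellPairing (sum_box_tsum_mul_periodic)
open Summit.QuantumFields.BalabanUV.Beta.GAN24.ZeroModeReflectionParityWords (tsum_tsum_conjW₁_diagK_eq tsum_tsum_conjW₂_diagK_eq sum_box_tsum_tsum_recentre)
open Summit.QuantumFields.BalabanUV.Beta.GAN24.CombCubicCellChargeZero (mul_ctGen_inl cubicCellCharge_SpureRecAt_eq_zero tsum_bhKStepAt_inl_inl_row_eq_zero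
  tsum_bhKStepAt_inl_inl_col_eq_zero summable_bhKStepAt_row summable_bhKStepAt_col)

namespace Summit.QuantumFields.BalabanUV.Beta.GAN24.CombQuarticContactChargeZero

variable {d : ℕ}

/-! ## §1 Zero letters: classes, and `conjW` with zero letters -/

/-- [folklore] The zero kernel decays with any nonnegative constant. -/
theorem decays_zero' {C δ : ℝ} (hC : 0 ≤ C) : Decays (0 : MKer (d + 1) (Fib d)) C δ := by
  intro x y a b
  simp only [Pi.zero_apply, abs_zero]
  positivity

/-- [folklore] The zero bi-stencil family is `LocStencil₂` with constant `0`. -/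
theorem locStencil₂_zero' (δ : ℝ) :
    LocStencil₂ (fun (_ : Fin (d + 1)) (_ : Fin (d + 1) → ℤ) (_ : Fin (d + 1)) (_ : Fin (d + 1) → ℤ) => (0 : MKer (d + 1) (Fib d))) 0 δ := by
  intro κ u κ' u' x y a b
  simp only [Pi.zero_apply, abs_zero]
  positivity

/-- [folklore] `0 ∘ K = 0`. -/
theorem comp_zero_left' (K : MKer (d + 1) (Fib d)) : comp 0 K = 0 := by
  funext x z a b
  simp only [comp, Pi.zero_apply, zero_mul, Finset.sum_const_zero, tsum_zero]

/-- [folklore] `A ∘ 0 = 0`. -/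
theorem comp_zero_right' (A : MKer (d + 1) (Fib d)) : comp A 0 = 0 := by
  funext x z a b
  simp only [comp, Pi.zero_apply, mul_zero, Finset.sum_const_zero, tsum_zero]

/-- [folklore] **`conjW` WITH ZERO SANDWICH AND ZERO SECOND SYMBOL IS `conjW₁`**. -/
theorem conjW_zero_sandwich (V V' X X' : MKer (d + 1) (Fib d)) : conjW 0 V V' X X' 0 = conjW₁ V V' X X' := by
  unfold ChartConjugation.conjW ChartConjugation.conjW₂
  simp only [comp_zero_left', comp_zero_right', add_zero, sub_self]

/-- [folklore] **`conjW` WITH ZERO CUBIC LETTERS IS `conjW₂`**. -/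
theorem conjW_zero_letters (M X X' X₂ : MKer (d + 1) (Fib d)) : conjW M 0 0 X X' X₂ = conjW₂ M X X' X₂ := by
  unfold ChartConjugation.conjW ChartConjugation.conjW₁
  simp only [comp_zero_left', comp_zero_right', sub_self, add_zero, zero_add]

/-! ## §2 Bond-slot summabilities with one kernel leg pinned; the first-leg re-centring -/

section Bond

variable {S : Fin (d + 1) → (Fin (d + 1) → ℤ) → MKer (d + 1) (Fib d)} {C δ : ℝ}

/-- [folklore] `u ↦ Σ'_x S κ′ u x z` is summable (second kernel leg pinned): `|Σ'_x S κ′ u x z| ≤ C·Zl·e^{−δ|z − u|₁}` by the transposed row bound. -/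
theorem summable_bond_tsum_fst (hS : LocStencil S C δ) (hδ : 0 < δ) (κ' : Fin (d + 1)) (z : Fin (d + 1) → ℤ) (a b : Fib d) :
    Summable fun u => ∑' x, S κ' u x z a b := by
  refine Summable.of_norm_bounded ((summable_exp_shift hδ z).mul_left (C * Zl (d + 1) δ)) (fun u => ?_)
  rw [Real.norm_eq_abs]
  have h := abs_tsum_z_le (biLoc_trK (hS κ' u)) hδ z b a
  simp only [trK_apply] at h
  exact h

/-- [folklore] `u ↦ Σ'_z S κ′ u x z` is summable (first kernel leg pinned): `|Σ'_z S κ′ u x z| ≤ C·Zl·e^{−δ|x − u|₁}`. -/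
theorem summable_bond_tsum_snd (hS : LocStencil S C δ) (hδ : 0 < δ) (κ' : Fin (d + 1)) (x : Fin (d + 1) → ℤ) (a b : Fib d) :
    Summable fun u => ∑' z, S κ' u x z a b := by
  refine Summable.of_norm_bounded ((summable_exp_shift hδ x).mul_left (C * Zl (d + 1) δ)) (fun u => ?_)
  rw [Real.norm_eq_abs]
  exact abs_tsum_z_le (hS κ' u) hδ x a b

/-- NOT IN PRINT; OUR BOOKKEEPING.  **FIRST-LEG RE-CENTRING**: for an `N`-block-covariant local stencil family,
`Σ_{r∈box} Σ'_u Σ'_z S κ′ u (toSite r) z = Σ_{r∈box} Σ'_x Σ'_z S κ′ (toSite r) x z` (leaf-04's `sum_box_tsum_mul_periodic` at `A := 1` on `j u x := Σ'_z S κ′ u x z`). -/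
theorem sum_box_tsum_tsum_recentre_fst {N : ℕ} [NeZero N] (hS : LocStencil S C δ) (hδ : 0 < δ) (κ' : Fin (d + 1)) (a b : Fib d)
    (hcov : ∀ (u t : Fin (d + 1) → ℤ), S κ' (u + (N : ℤ) • t) = shiftK (-((N : ℤ) • t)) (S κ' u)) :
    ∑ r ∈ box (d + 1) N, ∑' u, ∑' z, S κ' u (toSite r) z a b = ∑ r ∈ box (d + 1) N, ∑' x, ∑' z, S κ' (toSite r) x z a b := by
  have hc : ∀ u x t : Fin (d + 1) → ℤ, (∑' z, S κ' (u + (N : ℤ) • t) (x + (N : ℤ) • t) z a b) = ∑' z, S κ' u x z a b := by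
    intro u x t
    rw [hcov, ← (Equiv.addRight ((N : ℤ) • t)).tsum_eq (fun z => shiftK (-((N : ℤ) • t)) (S κ' u) (x + (N : ℤ) • t) z a b)]
    refine tsum_congr fun z => ?_
    simp only [shiftK, Equiv.coe_addRight, add_neg_cancel_right]
  have h := sum_box_tsum_mul_periodic (N := N) (j := fun u x => ∑' z, S κ' u x z a b) (A := fun _ => (1 : ℝ)) hc (fun _ _ => rfl)
    (fun x => summable_bond_tsum_snd hS hδ κ' x a b) (fun u => by simp only [mul_one]; exact summable_xz (hS κ' u) hδ a b)
  simp only [mul_one] at h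
  exact h.symm

end Bond

/-! ## §3 The `conjW₁` half carries no ff charge (generic) -/

section First

variable {N : ℕ} [NeZero N] {S : Fin (d + 1) → (Fin (d + 1) → ℤ) → MKer (d + 1) (Fib d)} {C δ : ℝ}
  {g : Fin (d + 1) → (Fin (d + 1) → ℤ) → (Fin (d + 1) → ℤ) → Fib d → ℝ} {c : Fin (d + 1) → ℝ}

/-- NOT IN PRINT; OUR BOOKKEEPING.  **THE `conjW₁` FAMILY OF A TABLE WITH ZERO CUBIC CELL CHARGES CARRIES NO ff CHARGE**: for a local, `N`-block-covariant stencil family `S`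
whose cubic cell charges `Σ_{r∈box} Σ'_x Σ'_z S κ′ (toSite r) x z (inl κ₁)(inl κ₂)` all vanish, and generators `diagK (g κ u)` with same-bond delta field legs
`g κ u x (inl β) = [x = u ∧ β = κ]·c κ`, every pattern: `zmode N (κ u κ′ u′ ↦ conjW₁ (S κ u) (S κ′ u′) (diagK (g κ u)) (diagK (g κ′ u′))) κ κ′ (inl κ₁) (inl κ₂) = 0`. -/
theorem zmode_conjW₁_eq_zero (hS : LocStencil S C δ) (hδ : 0 < δ)
    (hcov : ∀ (κ' : Fin (d + 1)) (u t : Fin (d + 1) → ℤ), S κ' (u + (N : ℤ) • t) = shiftK (-((N : ℤ) • t)) (S κ' u))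
    (hcubic : ∀ κ' κ₁ κ₂ : Fin (d + 1), ∑ r ∈ box (d + 1) N, ∑' x, ∑' z, S κ' (toSite r) x z (Sum.inl κ₁) (Sum.inl κ₂) = 0)
    (hg : ∀ (κ : Fin (d + 1)) (u x : Fin (d + 1) → ℤ) (β : Fin (d + 1)), g κ u x (Sum.inl β) = if x = u ∧ β = κ then c κ else 0)
    (κ κ' κ₁ κ₂ : Fin (d + 1)) :
    zmode N (fun κ u κ' u' => conjW₁ (S κ u) (S κ' u') (diagK (g κ u)) (diagK (g κ' u'))) κ κ' (Sum.inl κ₁) (Sum.inl κ₂) = 0 := by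
  classical
  have hrow : ∀ κ u x (a b : Fin (d + 1)), Summable fun z => S κ u x z (Sum.inl a) (Sum.inl b) := fun κ u x a b => summable_z (hS κ u) hδ x _ _
  have hcol : ∀ κ u z (a b : Fin (d + 1)), Summable fun x => S κ u x z (Sum.inl a) (Sum.inl b) := fun κ u z a b => summable_col_of_biLoc (hS κ u) hδ z _ _
  -- the four one-leg-pinned sums, as functions of the cell offset `r` and the free bond `u′`
  set A₁ : (Fin (d + 1) → ℕ) → (Fin (d + 1) → ℤ) → ℝ := fun r u' => ∑' x, S κ' u' x (toSite r) (Sum.inl κ₁) (Sum.inl κ₂) with hA₁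
  set A₂ : (Fin (d + 1) → ℕ) → (Fin (d + 1) → ℤ) → ℝ := fun r u' => ∑' z, S κ' u' (toSite r) z (Sum.inl κ₁) (Sum.inl κ₂) with hA₂
  set A₃ : (Fin (d + 1) → ℕ) → (Fin (d + 1) → ℤ) → ℝ := fun r u' => ∑' x, S κ (toSite r) x u' (Sum.inl κ₁) (Sum.inl κ₂) with hA₃
  set A₄ : (Fin (d + 1) → ℕ) → (Fin (d + 1) → ℤ) → ℝ := fun r u' => ∑' z, S κ (toSite r) u' z (Sum.inl κ₁) (Sum.inl κ₂) with hA₄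
  set b₁ : ℝ := if κ₂ = κ then 1 else 0 with hb₁
  set b₂ : ℝ := if κ₁ = κ then 1 else 0 with hb₂
  set b₃ : ℝ := if κ₂ = κ' then 1 else 0 with hb₃
  set b₄ : ℝ := if κ₁ = κ' then 1 else 0 with hb₄
  -- the inner double sum at `(r, u′)` (g47's `tsum_tsum_conjW₁_diagK_eq`)
  have inner : ∀ (r : Fin (d + 1) → ℕ) (u' : Fin (d + 1) → ℤ),
      (∑' x, ∑' z, conjW₁ (S κ (toSite r)) (S κ' u') (diagK (g κ (toSite r))) (diagK (g κ' u')) x z (Sum.inl κ₁) (Sum.inl κ₂))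
        = c κ * (b₁ * A₁ r u' - b₂ * A₂ r u') + c κ' * (b₃ * A₃ r u' - b₄ * A₄ r u') := by
    intro r u'
    rw [tsum_tsum_conjW₁_diagK_eq (hg κ (toSite r)) (hg κ' u') (hrow κ (toSite r)) (hcol κ (toSite r)) (hrow κ' u') (hcol κ' u') κ₁ κ₂]
    simp only [hA₁, hA₂, hA₃, hA₄, hb₁, hb₂, hb₃, hb₄]
    split_ifs <;> ring
  -- summability in the free bond of the four pinned sums
  have s₁ : ∀ r, Summable fun u' => A₁ r u' := fun r => summable_bond_tsum_fst hS hδ κ' (toSite r) _ _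
  have s₂ : ∀ r, Summable fun u' => A₂ r u' := fun r => summable_bond_tsum_snd hS hδ κ' (toSite r) _ _
  have s₃ : ∀ r, Summable fun u' => A₃ r u' := fun r =>
    (summable_prod_of_biLoc (hS κ (toSite r)) hδ (Sum.inl κ₁) (Sum.inl κ₂)).prod_symm.prod
  have s₄ : ∀ r, Summable fun u' => A₄ r u' := fun r => summable_xz (hS κ (toSite r)) hδ _ _
  -- the bond sum at fixed `r`
  have bond : ∀ r : Fin (d + 1) → ℕ,
      (∑' u', ∑' x, ∑' z, conjW₁ (S κ (toSite r)) (S κ' u') (diagK (g κ (toSite r))) (diagK (g κ' u')) x z (Sum.inl κ₁) (Sum.inl κ₂))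
        = c κ * (b₁ * ∑' u', A₁ r u' - b₂ * ∑' u', A₂ r u') + c κ' * (b₃ * ∑' u', A₃ r u' - b₄ * ∑' u', A₄ r u') := by
    intro r
    simp_rw [inner r]
    rw [(((s₁ r).mul_left b₁).sub ((s₂ r).mul_left b₂)).mul_left (c κ) |>.tsum_add ((((s₃ r).mul_left b₃).sub ((s₄ r).mul_left b₄)).mul_left (c κ')),
      tsum_mul_left, tsum_mul_left, ((s₁ r).mul_left b₁).tsum_sub ((s₂ r).mul_left b₂), ((s₃ r).mul_left b₃).tsum_sub ((s₄ r).mul_left b₄),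
      tsum_mul_left, tsum_mul_left, tsum_mul_left, tsum_mul_left]
  -- the four cell sums are cubic cell charges
  have c₁ : ∑ r ∈ box (d + 1) N, ∑' u', A₁ r u' = 0 := by
    simp only [hA₁]
    rw [sum_box_tsum_tsum_recentre κ' κ₁ κ₂ (hcov κ') (fun z => summable_bond_tsum_fst hS hδ κ' z _ _)
      (fun u => summable_prod_of_biLoc (hS κ' u) hδ (Sum.inl κ₁) (Sum.inl κ₂))]
    exact hcubic κ' κ₁ κ₂
  have c₂ : ∑ r ∈ box (d + 1) N, ∑' u', A₂ r u' = 0 := by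
    simp only [hA₂]
    rw [sum_box_tsum_tsum_recentre_fst hS hδ κ' _ _ (hcov κ')]
    exact hcubic κ' κ₁ κ₂
  have c₃ : ∑ r ∈ box (d + 1) N, ∑' u', A₃ r u' = 0 := by
    simp only [hA₃]
    have hP : ∀ r : Fin (d + 1) → ℕ, Summable (Function.uncurry fun x u' => S κ (toSite r) x u' (Sum.inl κ₁) (Sum.inl κ₂)) := fun r =>
      summable_prod_of_biLoc (hS κ (toSite r)) hδ (Sum.inl κ₁) (Sum.inl κ₂)
    rw [Finset.sum_congr rfl fun r _ => (hP r).tsum_comm]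
    exact hcubic κ κ₁ κ₂
  have c₄ : ∑ r ∈ box (d + 1) N, ∑' u', A₄ r u' = 0 := by
    simp only [hA₄]
    exact hcubic κ κ₁ κ₂
  -- assemble
  show ∑ r ∈ box (d + 1) N, ∑' u', ∑' x, ∑' z,
      conjW₁ (S κ (toSite r)) (S κ' u') (diagK (g κ (toSite r))) (diagK (g κ' u')) x z (Sum.inl κ₁) (Sum.inl κ₂) = 0
  rw [Finset.sum_congr rfl fun r _ => bond r]
  simp only [Finset.sum_add_distrib, Finset.sum_sub_distrib, ← Finset.mul_sum, c₁, c₂, c₃, c₄, mul_zero, sub_self, add_zero]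

end First

/-! ## §4 The `conjW₂` half carries no ff charge (generic) -/

section Second

variable {N : ℕ} {𝕄 : MKer (d + 1) (Fib d)}
  {g : Fin (d + 1) → (Fin (d + 1) → ℤ) → (Fin (d + 1) → ℤ) → Fib d → ℝ} {c : Fin (d + 1) → ℝ}
  {h : Fin (d + 1) → (Fin (d + 1) → ℤ) → Fin (d + 1) → (Fin (d + 1) → ℤ) → (Fin (d + 1) → ℤ) → Fib d → ℝ}

/-- NOT IN PRINT; OUR BOOKKEEPING.  **THE `conjW₂` FAMILY CARRIES NO ff CHARGE**: for a sandwich kernel `𝕄` with summable rows∕columns and ZERO ff constant modes on both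
sides, generators with same-bond delta field legs and a second symbol whose field leg is finitely supported at every bond pair, every pattern:
`zmode N (κ u κ′ u′ ↦ conjW₂ 𝕄 (diagK (g κ u)) (diagK (g κ′ u′)) (diagK (h κ u κ′ u′))) κ κ′ (inl κ₁) (inl κ₂) = 0` — the surviving sandwich entries `𝕄 u u′`, `𝕄 u′ u` of
g47's `tsum_tsum_conjW₂_diagK_eq` are, after the free-bond sum, a row and a column constant mode. -/
theorem zmode_conjW₂_eq_zero
    (hg : ∀ (κ : Fin (d + 1)) (u x : Fin (d + 1) → ℤ) (β : Fin (d + 1)), g κ u x (Sum.inl β) = if x = u ∧ β = κ then c κ else 0)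
    (hh : ∀ (κ : Fin (d + 1)) (u : Fin (d + 1) → ℤ) (κ' : Fin (d + 1)) (u' : Fin (d + 1) → ℤ),
      ∃ s : Finset (Fin (d + 1) → ℤ), ∀ x ∉ s, ∀ (β : Fin (d + 1)), h κ u κ' u' x (Sum.inl β) = 0)
    (hMrow : ∀ (x : Fin (d + 1) → ℤ) (a b : Fin (d + 1)), Summable fun z => 𝕄 x z (Sum.inl a) (Sum.inl b))
    (hMcol : ∀ (z : Fin (d + 1) → ℤ) (a b : Fin (d + 1)), Summable fun x => 𝕄 x z (Sum.inl a) (Sum.inl b))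
    (hrow0 : ∀ (x : Fin (d + 1) → ℤ) (a b : Fin (d + 1)), ∑' z, 𝕄 x z (Sum.inl a) (Sum.inl b) = 0)
    (hcol0 : ∀ (z : Fin (d + 1) → ℤ) (a b : Fin (d + 1)), ∑' x, 𝕄 x z (Sum.inl a) (Sum.inl b) = 0)
    (κ κ' κ₁ κ₂ : Fin (d + 1)) :
    zmode N (fun κ u κ' u' => conjW₂ 𝕄 (diagK (g κ u)) (diagK (g κ' u')) (diagK (h κ u κ' u'))) κ κ' (Sum.inl κ₁) (Sum.inl κ₂) = 0 := by
  classical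
  have bond : ∀ r : Fin (d + 1) → ℕ,
      (∑' u', ∑' x, ∑' z, conjW₂ 𝕄 (diagK (g κ (toSite r))) (diagK (g κ' u')) (diagK (h κ (toSite r) κ' u')) x z (Sum.inl κ₁) (Sum.inl κ₂)) = 0 := by
    intro r
    have inner : ∀ u' : Fin (d + 1) → ℤ,
        (∑' x, ∑' z, conjW₂ 𝕄 (diagK (g κ (toSite r))) (diagK (g κ' u')) (diagK (h κ (toSite r) κ' u')) x z (Sum.inl κ₁) (Sum.inl κ₂))
          = -((if κ₁ = κ ∧ κ₂ = κ' then c κ * c κ' * 𝕄 (toSite r) u' (Sum.inl κ) (Sum.inl κ') else 0)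
              + (if κ₁ = κ' ∧ κ₂ = κ then c κ' * c κ * 𝕄 u' (toSite r) (Sum.inl κ') (Sum.inl κ) else 0)) := by
      intro u'
      obtain ⟨s, hs⟩ := hh κ (toSite r) κ' u'
      exact tsum_tsum_conjW₂_diagK_eq (hg κ (toSite r)) (hg κ' u') hs hMrow hMcol hrow0 hcol0 κ₁ κ₂
    simp_rw [inner]
    rw [tsum_neg, neg_eq_zero]
    by_cases h1 : κ₁ = κ ∧ κ₂ = κ'
    · by_cases h2 : κ₁ = κ' ∧ κ₂ = κ
      · simp_rw [if_pos h1, if_pos h2]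
        rw [((hMrow (toSite r) κ κ').mul_left (c κ * c κ')).tsum_add ((hMcol (toSite r) κ' κ).mul_left (c κ' * c κ)), tsum_mul_left, tsum_mul_left,
          hrow0, hcol0, mul_zero, mul_zero, add_zero]
      · simp_rw [if_pos h1, if_neg h2, add_zero]
        rw [tsum_mul_left, hrow0, mul_zero]
    · by_cases h2 : κ₁ = κ' ∧ κ₂ = κ
      · simp_rw [if_neg h1, if_pos h2, zero_add]
        rw [tsum_mul_left, hcol0, mul_zero]
      · simp_rw [if_neg h1, if_neg h2, add_zero]
        exact tsum_zero
  show ∑ r ∈ box (d + 1) N, ∑' u', ∑' x, ∑' z,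
      conjW₂ 𝕄 (diagK (g κ (toSite r))) (diagK (g κ' u')) (diagK (h κ (toSite r) κ' u')) x z (Sum.inl κ₁) (Sum.inl κ₂) = 0
  exact Finset.sum_eq_zero fun r _ => bond r

end Second

/-! ## §5 The comb instance: the whole contact defect carries no ff charge -/

section Comb

variable {Lc : ℕ} [NeZero Lc]

/-- NOT IN PRINT; OUR BOOKKEEPING.  **THE CONTACT DEFECT OF THE COMB TOWER's QUARTIC REFLECTION LAW CARRIES NO ff CHARGE** — every level `j`, every axis `α`, every pattern
`(κ, κ′; κ₁, κ₂)`, at the pin `(cE, cVH) = (Lc⁴, −Lc⁸∕2)`, any `cΛ`, any generator scalar `γ` and second-symbol scalar `γ₂` (an2's law has `γ = γ_j`, `γ₂ = γ_j²`):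
`zmode Lc (κ u κ′ u′ ↦ conjW (bhKStepAt 3 ρ_c Lc j) (S_j κ u) (S_j κ′ u′) (diagK (γ·ctGen 3 α Lc κ u)) (diagK (γ·ctGen 3 α Lc κ′ u′)) (diagK (γ₂·ctGen κ u·ctGen κ′ u′))) κ κ′ (inl κ₁) (inl κ₂) = 0`. -/
theorem zmode_conjW_comb_eq_zero (hLc : Odd Lc) (cΛ γ γ₂ : ℝ) (j : ℕ) (α κ κ' κ₁ κ₂ : Fin 4) :
    zmode Lc (fun κ u κ' u' =>
        conjW (bhKStepAt 3 (toSite (ctrOff 4 Lc)) Lc j)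
          (SpureRecAt 3 Lc (toSite (ctrOff 4 Lc)) ((Lc : ℝ) ^ 4) (-((Lc : ℝ) ^ 8 / 2)) cΛ j κ u)
          (SpureRecAt 3 Lc (toSite (ctrOff 4 Lc)) ((Lc : ℝ) ^ 4) (-((Lc : ℝ) ^ 8 / 2)) cΛ j κ' u')
          (diagK fun p a => γ * ctGen 3 α Lc κ u p a) (diagK fun p a => γ * ctGen 3 α Lc κ' u' p a)
          (diagK fun p a => γ₂ * (ctGen 3 α Lc κ u p a * ctGen 3 α Lc κ' u' p a)))
      κ κ' (Sum.inl κ₁) (Sum.inl κ₂) = 0 := by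
  classical
  have hL1 : 1 ≤ Lc := hLc.pos
  have hr := ctrOff_mem_box (d := 4) hL1
  -- classes at one common rate
  obtain ⟨Cs, δs, hδs, hS⟩ := locStencil_SpureRecAt (d := 3) (Lc := Lc) hL1 hr ((Lc : ℝ) ^ 4) (-((Lc : ℝ) ^ 8 / 2)) cΛ j
  obtain ⟨C𝕄, δ𝕄, hδ𝕄, h𝕄⟩ := spr_bhKStepAt (d := 3) (Lc := Lc) hr j
  set δ : ℝ := min δs δ𝕄 with hδdef
  have hδ : 0 < δ := lt_min hδs hδ𝕄
  have hCs : 0 ≤ Cs := (hS 0 0).nonneg (Sum.inl 0)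
  have hC𝕄 : 0 ≤ C𝕄 := h𝕄.nonneg (Sum.inl 0)
  have hS' : LocStencil (SpureRecAt 3 Lc (toSite (ctrOff 4 Lc)) ((Lc : ℝ) ^ 4) (-((Lc : ℝ) ^ 8 / 2)) cΛ j) Cs δ :=
    locStencil_mono hS hCs (min_le_left _ _)
  have h𝕄' : Decays (bhKStepAt 3 (toSite (ctrOff 4 Lc)) Lc j) C𝕄 δ := decays_mono h𝕄 hC𝕄 le_rfl (min_le_right _ _)
  have hX := locStencil_diagK_smul_ctGen (d := 3) (Lc := Lc) γ α hδ.le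
  have hX₂ := locStencil₂_diagK_ctGen_mul_ctGen (d := 3) α Lc γ₂ hδ.le
  -- the two halves are `LocStencil₂` (an2's kit with zero letters)
  obtain ⟨C₁, hJ₁⟩ := locStencil₂_conjW (decays_zero' (d := 3) (δ := δ) le_rfl) hS' hX (locStencil₂_zero' (d := 3) δ) hδ
  obtain ⟨C₂, hJ₂⟩ := locStencil₂_conjW h𝕄' (Summit.QuantumFields.BalabanUV.Beta.D1BFx.LiteralStencilSockets.locStencil_zero (d := 3) (δ := δ) le_rfl) hX hX₂ hδ
  simp only [conjW_zero_sandwich] at hJ₁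
  simp only [conjW_zero_letters] at hJ₂
  -- split the defect and its charge
  have e : zmode Lc (fun κ u κ' u' =>
        conjW (bhKStepAt 3 (toSite (ctrOff 4 Lc)) Lc j)
          (SpureRecAt 3 Lc (toSite (ctrOff 4 Lc)) ((Lc : ℝ) ^ 4) (-((Lc : ℝ) ^ 8 / 2)) cΛ j κ u)
          (SpureRecAt 3 Lc (toSite (ctrOff 4 Lc)) ((Lc : ℝ) ^ 4) (-((Lc : ℝ) ^ 8 / 2)) cΛ j κ' u')
          (diagK fun p a => γ * ctGen 3 α Lc κ u p a) (diagK fun p a => γ * ctGen 3 α Lc κ' u' p a)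
          (diagK fun p a => γ₂ * (ctGen 3 α Lc κ u p a * ctGen 3 α Lc κ' u' p a))) κ κ' (Sum.inl κ₁) (Sum.inl κ₂)
      = zmode Lc (fun κ u κ' u' =>
          conjW₁ (SpureRecAt 3 Lc (toSite (ctrOff 4 Lc)) ((Lc : ℝ) ^ 4) (-((Lc : ℝ) ^ 8 / 2)) cΛ j κ u)
              (SpureRecAt 3 Lc (toSite (ctrOff 4 Lc)) ((Lc : ℝ) ^ 4) (-((Lc : ℝ) ^ 8 / 2)) cΛ j κ' u')
              (diagK fun p a => γ * ctGen 3 α Lc κ u p a) (diagK fun p a => γ * ctGen 3 α Lc κ' u' p a)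
            + conjW₂ (bhKStepAt 3 (toSite (ctrOff 4 Lc)) Lc j)
              (diagK fun p a => γ * ctGen 3 α Lc κ u p a) (diagK fun p a => γ * ctGen 3 α Lc κ' u' p a)
              (diagK fun p a => γ₂ * (ctGen 3 α Lc κ u p a * ctGen 3 α Lc κ' u' p a))) κ κ' (Sum.inl κ₁) (Sum.inl κ₂) := rfl
  rw [e, zmode_add (N := Lc) hJ₁ hJ₂ (by positivity) κ κ' (Sum.inl κ₁) (Sum.inl κ₂)]
  -- §3: the `conjW₁` half (zero cubic cell charges, `CombCubicCellChargeZero`)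
  rw [zmode_conjW₁_eq_zero (N := Lc) (c := fun κ => if κ = α then -γ else 0) hS' hδ
      (SpureRecAt_translate (d := 3) (toSite (ctrOff 4 Lc)) hL1 _ _ _ j) (cubicCellCharge_SpureRecAt_eq_zero hLc cΛ j)
      (fun κ u x β => mul_ctGen_inl γ α κ u x β) κ κ' κ₁ κ₂]
  -- §4: the `conjW₂` half (the sandwich kernel's Ward zeros)
  rw [zmode_conjW₂_eq_zero (N := Lc) (c := fun κ => if κ = α then -γ else 0) (fun κ u x β => mul_ctGen_inl γ α κ u x β) ?_
      (fun x a b => summable_bhKStepAt_row hr j x _ _) (fun z a b => summable_bhKStepAt_col hr j z _ _)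
      (fun x a b => tsum_bhKStepAt_inl_inl_row_eq_zero _ j x a b) (fun z a b => tsum_bhKStepAt_inl_inl_col_eq_zero _ j z a b) κ κ' κ₁ κ₂, add_zero]
  -- the canonical second symbol's field leg is supported at the first bond
  intro κ u κ' u'
  refine ⟨{u}, fun x hx β => ?_⟩
  rw [Finset.mem_singleton] at hx
  rw [ctGen_inl, if_neg (fun h => hx h.1), zero_mul, mul_zero]

end Comb

end Summit.QuantumFields.BalabanUV.Beta.GAN24.CombQuarticContactChargeZero

end
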